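import Summits.QuantumFields.YangMills.Theorems.AlphaInputsT3ACv3LinearLiftTorus1DLip
import HarnessLib

/-!
# `AlphaInputsT3ACv3LinearLiftSpreadLip` — (LL) STEP L2b-Lip: THE TENSOR SPREADING OPERATORS `S⁰_L, S¹_L, S²_L` WITH THE LIPSCHITZ PROFILES, THEIR CHAIN IDENTITIES,
# THE CURL-SPREADING BOUND AND ITS LIPSCHITZ ROW — cell `ym3-torus`, width seat `ym3-torus-px19` (g3), line «SYM-CENTRE» row (R3)

By-name twin of `AlphaInputsT3ACv3LinearLiftSpread` (seat `ym-ust-19936-w2` g0) with the periodised Lipschitz profiles `PσL`, `PτL` of `…Torus1DLip` (`hh`, `hside`, `hN`,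
`sum_shift`, `sum_abs_PS_le` reused BY NAME):
* §1 `S0L`, `S1L`, `S2L`; §2 ★ `dgrad_S0L : dgrad (S0L k λ) = S1L k (dgrad λ)`, ★ `curlAt_S1L : curlAt (S1L k A) x μ ν = S2L k (curlAt A) x μ ν` (`μ ≠ ν`) — proofs verbatim;
* §3 `abs_S2L_le`: `|G| ≤ ε ⇒ |S2L k G (x; μ, ν)| ≤ 54^d · ε / (L^k)²`, and ★★★ THE NEW ROW `abs_S2L_shift_sub_le`:
  `|S2L k G (x + e_λ; μ, ν) − S2L k G (x; μ, ν)| ≤ 330 · 54^{d−1} · ε / (L^k)³` for EVERY direction `λ` — the spread coarse curl is LIPSCHITZ AT SCALE `n = L^k`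
  (one power of `n` better than the sup bound), from the 1-D Lipschitz rows `Σ_c|ΔPτL| ≤ 330/n²`, `Σ_c|ΔPσL| ≤ 108/n` of `…Torus1DLip`.
The exactness `segIter k (S1L k A) = A` and the lift are the sibling `…LinearLiftTorusLip`.
HONEST FRAMING.  Lattice bookkeeping; nothing of [Balaban1987RG1]∕[Balaban1985UV3] asserted; count-neutral helper toward the symmetric-centre row of the EX display
(`--supports stmt-QuantumFields-19200`); registry untouched.  YM₃ on the torus is a RUNG of the programme, not the Clay problem; no claim about d = 4, infinite volume or a mass gap.

References: T. Bałaban, Commun. Math. Phys. 109 (1987) 249–301 [Balaban1987RG1] ((0.1) p.251, (0.4) p.253); Commun. Math. Phys. 102 (1985) 277–309 [Balaban1985Variational]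
(Thm 1 (8) p.279: the regularity window incl. the divergence clause).
-/

set_option autoImplicit false

noncomputable section

namespace Summit.QuantumFields.YangMills.Theorems.LinearLiftSpreadLip

open Finset
open Literature.MathematicalPhysics.QuantumFieldTheory.Balaban1983to89
open Summit.QuantumFields.YangMills.Theorems.AbelianEML (curlAt)
open Summit.QuantumFields.YangMills.Theorems.LinearLiftProfile
open Summit.QuantumFields.YangMills.Theorems.LinearLiftProfileLip
open Summit.QuantumFields.YangMills.Theorems.LinearLiftGauge (dgrad)
open Summit.QuantumFields.YangMills.Theorems.LinearLiftSpread (hh hside hN shift_bijective sum_shift sum_abs_PS_le)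
open Summit.QuantumFields.Balaban3D.Carriers (shift_apply_self shift_apply_ne)

variable {P : Params}

/-! ## §1 The spreading operators -/

/-- **`S⁰_L`: SPREADING A COARSE 0-FORM** — `S0L k λ (x) = Σ_y λ(y) Π_i Pσ(x_i, y_i)`. [folklore] -/
def S0L (k : ℕ) (lam : Site P k → ℝ) (x : Site P 0) : ℝ :=
  ∑ y : Site P k, lam y * ∏ i, PsigL (hh P k) (x i) (y i)

/-- **`S¹_L`: SPREADING A COARSE 1-FORM** — `S1L k A (x, μ) = Σ_y A(y, μ) · Pτ(x_μ, y_μ) · Π_{i ≠ μ} Pσ(x_i, y_i)`. [folklore] -/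
def S1L (k : ℕ) (A : PBond P k → ℝ) (b : PBond P 0) : ℝ :=
  ∑ y : Site P k, A ⟨y, b.dir⟩ * (PtauL (hh P k) (b.src b.dir) (y b.dir) * ∏ i ∈ univ.erase b.dir, PsigL (hh P k) (b.src i) (y i))

/-- **`S²_L`: SPREADING A COARSE 2-FORM** — `S2L k G (x; μ, ν) = Σ_y G(y; μ, ν) · Pτ(x_μ, y_μ) Pτ(x_ν, y_ν) · Π_{i ∉ {μ, ν}} Pσ(x_i, y_i)`. [folklore] -/
def S2L (k : ℕ) (G : Site P k → Fin P.d → Fin P.d → ℝ) (x : Site P 0) (μ ν : Fin P.d) : ℝ :=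
  ∑ y : Site P k, G y μ ν * (PtauL (hh P k) (x μ) (y μ) * PtauL (hh P k) (x ν) (y ν) * ∏ i ∈ (univ.erase μ).erase ν, PsigL (hh P k) (x i) (y i))


/-! ## §2 The chain identities -/

section Chain

variable (k : ℕ) (hk : k ≤ P.m + P.K)
include hk

/-- **★ `d ∘ S⁰ = S¹ ∘ d`**: the gradient of the spread 0-form is the spread of the coarse gradient. [folklore] -/
theorem dgrad_S0L (lam : Site P k → ℝ) : dgrad (S0L k lam) = S1L k (dgrad lam) := by
  funext b
  obtain ⟨x, μ⟩ := b
  have hN' := hN k hk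
  simp only [dgrad, S0L, S1L, PBond.tgt]
  -- split the product at `μ` on both fine sites
  have eprod : ∀ (z : Site P 0) (y : Site P k), ∏ i, PsigL (hh P k) (z i) (y i) = PsigL (hh P k) (z μ) (y μ) * ∏ i ∈ univ.erase μ, PsigL (hh P k) (z i) (y i) :=
    fun z y => (mul_prod_erase univ (fun i => PsigL (hh P k) (z i) (y i)) (mem_univ μ)).symm
  have eshift : ∀ y : Site P k, ∏ i ∈ univ.erase μ, PsigL (hh P k) ((x.shift μ) i) (y i) = ∏ i ∈ univ.erase μ, PsigL (hh P k) (x i) (y i) :=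
    fun y => prod_congr rfl fun i hi => by rw [shift_apply_ne x (ne_of_mem_erase hi)]
  -- the difference, term by term, through the chain identity on the circle
  have ediff : ∀ y : Site P k, lam y * ∏ i, PsigL (hh P k) ((x.shift μ) i) (y i) - lam y * ∏ i, PsigL (hh P k) (x i) (y i)
      = lam y * (PtauL (hh P k) (x μ) (y μ - 1) * ∏ i ∈ univ.erase μ, PsigL (hh P k) (x i) (y i))
        - lam y * (PtauL (hh P k) (x μ) (y μ) * ∏ i ∈ univ.erase μ, PsigL (hh P k) (x i) (y i)) := by
    intro y
    rw [eprod (x.shift μ) y, eprod x y, eshift y, shift_apply_self, ← mul_sub, ← sub_mul, PsigL_add_one_sub (hh P k) hN', sub_mul, mul_sub]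
  rw [← sum_sub_distrib, sum_congr rfl fun y _ => ediff y, sum_sub_distrib]
  -- re-index the first sum by `y ↦ y + e_μ`
  have eidx : ∑ y : Site P k, lam y * (PtauL (hh P k) (x μ) (y μ - 1) * ∏ i ∈ univ.erase μ, PsigL (hh P k) (x i) (y i))
      = ∑ y : Site P k, lam (y.shift μ) * (PtauL (hh P k) (x μ) (y μ) * ∏ i ∈ univ.erase μ, PsigL (hh P k) (x i) (y i)) := by
    rw [← sum_shift μ (fun y => lam y * (PtauL (hh P k) (x μ) (y μ - 1) * ∏ i ∈ univ.erase μ, PsigL (hh P k) (x i) (y i)))]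
    refine sum_congr rfl fun y _ => ?_
    rw [shift_apply_self, add_sub_cancel_right]
    congr 2
    exact prod_congr rfl fun i hi => by rw [shift_apply_ne y (ne_of_mem_erase hi)]
  rw [eidx, ← sum_sub_distrib]
  refine sum_congr rfl fun y _ => ?_
  ring

/-- **★ `curl ∘ S¹ = S² ∘ curl`**: the lattice curl of the spread 1-form is the spread of the coarse curl (`μ ≠ ν`). [folklore] -/
theorem curlAt_S1L (A : PBond P k → ℝ) (x : Site P 0) {μ ν : Fin P.d} (hμν : μ ≠ ν) :
    curlAt (S1L k A) x μ ν = S2L k (fun y μ' ν' => curlAt A y μ' ν') x μ ν := by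
  have hN' := hN k hk
  have hνμ : ν ≠ μ := fun h => hμν h.symm
  -- the product over `i ≠ μ` split at `ν`, and vice versa
  have hνmem : ν ∈ univ.erase μ := mem_erase.mpr ⟨hνμ, mem_univ ν⟩
  have hμmem : μ ∈ univ.erase ν := mem_erase.mpr ⟨hμν, mem_univ μ⟩
  have hsets : (univ.erase ν).erase μ = (univ.erase μ).erase ν := by
    ext i; simp only [mem_erase, mem_univ, and_true]; tauto
  have eμ : ∀ (z : Site P 0) (y : Site P k), ∏ i ∈ univ.erase μ, PsigL (hh P k) (z i) (y i)
      = PsigL (hh P k) (z ν) (y ν) * ∏ i ∈ (univ.erase μ).erase ν, PsigL (hh P k) (z i) (y i) :=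
    fun z y => (mul_prod_erase (univ.erase μ) (fun i => PsigL (hh P k) (z i) (y i)) hνmem).symm
  have eν : ∀ (z : Site P 0) (y : Site P k), ∏ i ∈ univ.erase ν, PsigL (hh P k) (z i) (y i)
      = PsigL (hh P k) (z μ) (y μ) * ∏ i ∈ (univ.erase μ).erase ν, PsigL (hh P k) (z i) (y i) := by
    intro z y; rw [← hsets]; exact (mul_prod_erase (univ.erase ν) (fun i => PsigL (hh P k) (z i) (y i)) hμmem).symm
  -- the inner products do not see the shifts in `μ` or `ν`
  have erest : ∀ (ρ : Fin P.d) (y : Site P k), ∏ i ∈ (univ.erase μ).erase ν, PsigL (hh P k) ((x.shift ρ) i) (y i)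
      = ∏ i ∈ (univ.erase μ).erase ν, PsigL (hh P k) (x i) (y i) ∨ (ρ ≠ μ ∧ ρ ≠ ν) := by
    intro ρ y
    by_cases h1 : ρ = μ
    · left; exact prod_congr rfl fun i hi => by
        rw [shift_apply_ne x (show i ≠ ρ from h1 ▸ ne_of_mem_erase (mem_of_mem_erase hi))]
    · by_cases h2 : ρ = ν
      · left; exact prod_congr rfl fun i hi => by rw [shift_apply_ne x (show i ≠ ρ from h2 ▸ ne_of_mem_erase hi)]
      · right; exact ⟨h1, h2⟩
  have erestμ : ∀ y : Site P k, ∏ i ∈ (univ.erase μ).erase ν, PsigL (hh P k) ((x.shift μ) i) (y i) = ∏ i ∈ (univ.erase μ).erase ν, PsigL (hh P k) (x i) (y i) :=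
    fun y => (erest μ y).resolve_right fun h => h.1 rfl
  have erestν : ∀ y : Site P k, ∏ i ∈ (univ.erase μ).erase ν, PsigL (hh P k) ((x.shift ν) i) (y i) = ∏ i ∈ (univ.erase μ).erase ν, PsigL (hh P k) (x i) (y i) :=
    fun y => (erest ν y).resolve_right fun h => h.2 rfl
  -- abbreviations
  set R : Site P k → ℝ := fun y => ∏ i ∈ (univ.erase μ).erase ν, PsigL (hh P k) (x i) (y i) with hR
  set Tμ : Site P k → ℝ := fun y => PtauL (hh P k) (x μ) (y μ) with hTμ
  set Tν : Site P k → ℝ := fun y => PtauL (hh P k) (x ν) (y ν) with hTν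
  -- the four terms of the curl
  have t1 : S1L k A ⟨x, μ⟩ = ∑ y, A ⟨y, μ⟩ * (Tμ y * (PsigL (hh P k) (x ν) (y ν) * R y)) := by
    simp only [S1L, hTμ, hR]; exact sum_congr rfl fun y _ => by rw [eμ]
  have t2 : S1L k A ⟨x.shift μ, ν⟩ = ∑ y, A ⟨y, ν⟩ * (Tν y * (PsigL (hh P k) (x μ + 1) (y μ) * R y)) := by
    simp only [S1L, hTν, hR]
    exact sum_congr rfl fun y _ => by rw [eν, shift_apply_ne x hνμ, shift_apply_self, erestμ]
  have t3 : S1L k A ⟨x.shift ν, μ⟩ = ∑ y, A ⟨y, μ⟩ * (Tμ y * (PsigL (hh P k) (x ν + 1) (y ν) * R y)) := by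
    simp only [S1L, hTμ, hR]
    exact sum_congr rfl fun y _ => by rw [eμ, shift_apply_ne x hμν, shift_apply_self, erestν]
  have t4 : S1L k A ⟨x, ν⟩ = ∑ y, A ⟨y, ν⟩ * (Tν y * (PsigL (hh P k) (x μ) (y μ) * R y)) := by
    simp only [S1L, hTν, hR]; exact sum_congr rfl fun y _ => by rw [eν]
  unfold curlAt
  rw [t1, t2, t3, t4]
  -- combine: the `ν`-terms give `A(y,ν)·Tν·(ΔPsig_μ)·R`, the `μ`-terms give `−A(y,μ)·Tμ·(ΔPsig_ν)·R`
  have eA : ∑ y, A ⟨y, ν⟩ * (Tν y * (PsigL (hh P k) (x μ + 1) (y μ) * R y)) - ∑ y, A ⟨y, ν⟩ * (Tν y * (PsigL (hh P k) (x μ) (y μ) * R y))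
      = ∑ y, A ⟨y.shift μ, ν⟩ * (Tμ y * Tν y * R y) - ∑ y, A ⟨y, ν⟩ * (Tμ y * Tν y * R y) := by
    rw [← sum_sub_distrib, ← sum_sub_distrib]
    have e1 : ∀ y, A ⟨y, ν⟩ * (Tν y * (PsigL (hh P k) (x μ + 1) (y μ) * R y)) - A ⟨y, ν⟩ * (Tν y * (PsigL (hh P k) (x μ) (y μ) * R y))
        = A ⟨y, ν⟩ * (Tν y * (PtauL (hh P k) (x μ) (y μ - 1) * R y)) - A ⟨y, ν⟩ * (Tμ y * Tν y * R y) := by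
      intro y
      have hc := PsigL_add_one_sub (hh P k) hN' (x μ) (y μ)
      simp only [hTμ]
      linear_combination (A ⟨y, ν⟩ * Tν y * R y) * hc
    rw [sum_congr rfl fun y _ => e1 y, sum_sub_distrib, sum_sub_distrib]
    congr 1
    rw [← sum_shift μ (fun y => A ⟨y, ν⟩ * (Tν y * (PtauL (hh P k) (x μ) (y μ - 1) * R y)))]
    refine sum_congr rfl fun y _ => ?_
    simp only [hTμ, hTν, hR, shift_apply_self, add_sub_cancel_right, shift_apply_ne y hνμ]
    have : ∏ i ∈ (univ.erase μ).erase ν, PsigL (hh P k) (x i) ((y.shift μ) i) = ∏ i ∈ (univ.erase μ).erase ν, PsigL (hh P k) (x i) (y i) :=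
      prod_congr rfl fun i hi => by rw [shift_apply_ne y (ne_of_mem_erase (mem_of_mem_erase hi))]
    rw [this]; ring
  have eB : ∑ y, A ⟨y, μ⟩ * (Tμ y * (PsigL (hh P k) (x ν + 1) (y ν) * R y)) - ∑ y, A ⟨y, μ⟩ * (Tμ y * (PsigL (hh P k) (x ν) (y ν) * R y))
      = ∑ y, A ⟨y.shift ν, μ⟩ * (Tμ y * Tν y * R y) - ∑ y, A ⟨y, μ⟩ * (Tμ y * Tν y * R y) := by
    rw [← sum_sub_distrib, ← sum_sub_distrib]
    have e1 : ∀ y, A ⟨y, μ⟩ * (Tμ y * (PsigL (hh P k) (x ν + 1) (y ν) * R y)) - A ⟨y, μ⟩ * (Tμ y * (PsigL (hh P k) (x ν) (y ν) * R y))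
        = A ⟨y, μ⟩ * (Tμ y * (PtauL (hh P k) (x ν) (y ν - 1) * R y)) - A ⟨y, μ⟩ * (Tμ y * Tν y * R y) := by
      intro y
      have hc := PsigL_add_one_sub (hh P k) hN' (x ν) (y ν)
      simp only [hTν]
      linear_combination (A ⟨y, μ⟩ * Tμ y * R y) * hc
    rw [sum_congr rfl fun y _ => e1 y, sum_sub_distrib, sum_sub_distrib]
    congr 1
    rw [← sum_shift ν (fun y => A ⟨y, μ⟩ * (Tμ y * (PtauL (hh P k) (x ν) (y ν - 1) * R y)))]
    refine sum_congr rfl fun y _ => ?_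
    simp only [hTμ, hTν, hR, shift_apply_self, add_sub_cancel_right, shift_apply_ne y hμν]
    have : ∏ i ∈ (univ.erase μ).erase ν, PsigL (hh P k) (x i) ((y.shift ν) i) = ∏ i ∈ (univ.erase μ).erase ν, PsigL (hh P k) (x i) (y i) :=
      prod_congr rfl fun i hi => by rw [shift_apply_ne y (ne_of_mem_erase hi)]
    rw [this]; ring
  have key : (∑ y, A ⟨y, μ⟩ * (Tμ y * (PsigL (hh P k) (x ν) (y ν) * R y))) + (∑ y, A ⟨y, ν⟩ * (Tν y * (PsigL (hh P k) (x μ + 1) (y μ) * R y)))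
      - (∑ y, A ⟨y, μ⟩ * (Tμ y * (PsigL (hh P k) (x ν + 1) (y ν) * R y))) - (∑ y, A ⟨y, ν⟩ * (Tν y * (PsigL (hh P k) (x μ) (y μ) * R y)))
      = (∑ y, A ⟨y.shift μ, ν⟩ * (Tμ y * Tν y * R y) - ∑ y, A ⟨y, ν⟩ * (Tμ y * Tν y * R y))
        - (∑ y, A ⟨y.shift ν, μ⟩ * (Tμ y * Tν y * R y) - ∑ y, A ⟨y, μ⟩ * (Tμ y * Tν y * R y)) := by
    rw [← eA, ← eB]; ring
  rw [key]
  simp only [S2L, hTμ, hTν, hR, ← sum_sub_distrib]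
  refine sum_congr rfl fun y _ => ?_
  ring

end Chain


/-! ## §3 The curl-spreading bound and its Lipschitz row -/

/-- **THE CURL-SPREADING BOUND**: if `|G(y; μ, ν)| ≤ ε` for every coarse site then `|S2L k G (x; μ, ν)| ≤ 54^d · ε / (L^k)²` (`μ ≠ ν`). [folklore] -/
theorem abs_S2L_le (k : ℕ) (G : Site P k → Fin P.d → Fin P.d → ℝ) (x : Site P 0) {μ ν : Fin P.d} (hμν : μ ≠ ν) {ε : ℝ}
    (hG : ∀ y, |G y μ ν| ≤ ε) :
    |S2L k G x μ ν| ≤ (54 : ℝ) ^ P.d * ε / ((P.L : ℝ) ^ k) ^ 2 := by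
  have hε : 0 ≤ ε := (abs_nonneg _).trans (hG (fun _ => 0))
  have hn : (0 : ℝ) < side (hh P k) := side_real_pos _
  have hνμ : ν ≠ μ := fun h => hμν h.symm
  -- the weight of `y` as a product over ALL coordinates of per-coordinate factors
  let w : Fin P.d → ZMod (P.sitesPerDir 0) → ZMod (P.sitesPerDir k) → ℝ := fun i a c =>
    if i = μ ∨ i = ν then PtauL (hh P k) a c else PsigL (hh P k) a c
  have hw : ∀ y : Site P k, PtauL (hh P k) (x μ) (y μ) * PtauL (hh P k) (x ν) (y ν) * ∏ i ∈ (univ.erase μ).erase ν, PsigL (hh P k) (x i) (y i)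
      = ∏ i, w i (x i) (y i) := by
    intro y
    rw [← mul_prod_erase univ (fun i => w i (x i) (y i)) (mem_univ μ),
      ← mul_prod_erase (univ.erase μ) (fun i => w i (x i) (y i)) (mem_erase.mpr ⟨hνμ, mem_univ ν⟩)]
    simp only [w, if_pos (Or.inl rfl), if_pos (Or.inr rfl), mul_assoc]
    congr 2
    exact prod_congr rfl fun i hi => by
      rw [if_neg (not_or.mpr ⟨ne_of_mem_erase (mem_of_mem_erase hi), ne_of_mem_erase hi⟩)]
  -- per-coordinate sums of absolute values
  have hsum : ∀ i, ∑ c : ZMod (P.sitesPerDir k), |w i (x i) c| ≤ if i = μ ∨ i = ν then (54 : ℝ) / (side (hh P k) : ℝ) else (54 : ℝ) := by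
    intro i
    by_cases h : i = μ ∨ i = ν
    · simp only [w, if_pos h]
      have := sum_abs_PS_le (Nk := P.sitesPerDir k) (hh P k) (tauL (hh P k)) (abs_tauL_le (hh P k)) (qIdx (hh P k) (x i) : ℤ) (tOff (hh P k) (x i))
      unfold PtauL
      calc _ ≤ 3 * (18 / (side (hh P k) : ℝ)) := this
        _ = 54 / side (hh P k) := by ring
    · simp only [w, if_neg h]
      have := sum_abs_PS_le (Nk := P.sitesPerDir k) (hh P k) (sigmaL (hh P k)) (abs_sigmaL_le (hh P k)) (qIdx (hh P k) (x i) : ℤ) (tOff (hh P k) (x i))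
      unfold PsigL
      linarith
  calc |S2L k G x μ ν| = |∑ y : Site P k, G y μ ν * ∏ i, w i (x i) (y i)| := by
        unfold S2L; exact congrArg _ (sum_congr rfl fun y _ => by rw [hw])
    _ ≤ ∑ y : Site P k, |G y μ ν * ∏ i, w i (x i) (y i)| := abs_sum_le_sum_abs _ _
    _ ≤ ∑ y : Site P k, ε * ∏ i, |w i (x i) (y i)| := by
        refine sum_le_sum fun y _ => ?_
        rw [abs_mul, abs_prod]
        exact mul_le_mul_of_nonneg_right (hG y) (prod_nonneg fun i _ => abs_nonneg _)
    _ = ε * ∏ i, ∑ c : ZMod (P.sitesPerDir k), |w i (x i) c| := by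
        rw [← mul_sum, Finset.prod_univ_sum]
        rfl
    _ ≤ ε * ∏ i, (if i = μ ∨ i = ν then (54 : ℝ) / (side (hh P k) : ℝ) else (54 : ℝ)) := by
        refine mul_le_mul_of_nonneg_left ?_ hε
        exact prod_le_prod (fun i _ => sum_nonneg fun c _ => abs_nonneg _) fun i _ => hsum i
    _ = ε * ((54 : ℝ) ^ P.d / (side (hh P k) : ℝ) ^ 2) := by
        congr 1
        rw [← mul_prod_erase univ _ (mem_univ μ), ← mul_prod_erase (univ.erase μ) _ (mem_erase.mpr ⟨hνμ, mem_univ ν⟩)]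
        rw [if_pos (Or.inl rfl), if_pos (Or.inr rfl)]
        have hrest : ∏ i ∈ (univ.erase μ).erase ν, (if i = μ ∨ i = ν then (54 : ℝ) / (side (hh P k) : ℝ) else (54 : ℝ)) = (54 : ℝ) ^ ((univ.erase μ).erase ν).card := by
          rw [← prod_const]
          exact prod_congr rfl fun i hi => by rw [if_neg (not_or.mpr ⟨ne_of_mem_erase (mem_of_mem_erase hi), ne_of_mem_erase hi⟩)]
        rw [hrest, card_erase_of_mem (mem_erase.mpr ⟨hνμ, mem_univ ν⟩), card_erase_of_mem (mem_univ μ), card_univ, Fintype.card_fin]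
        have hd : 2 ≤ P.d := by
          have : ({μ, ν} : Finset (Fin P.d)).card ≤ Fintype.card (Fin P.d) := Finset.card_le_univ _
          rw [card_pair hμν, Fintype.card_fin] at this
          exact this
        have e : (54 : ℝ) ^ P.d = 54 * 54 * (54 : ℝ) ^ (P.d - 1 - 1) := by
          rw [← pow_two, ← pow_add]; congr 1; omega
        rw [e]; field_simp
    _ = (54 : ℝ) ^ P.d * ε / ((P.L : ℝ) ^ k) ^ 2 := by
        rw [show (side (hh P k) : ℝ) = (P.L : ℝ) ^ k by rw [hside]; push_cast; ring]; ring


/-- **★★★ THE LIPSCHITZ ROW OF THE CURL SPREADING**: if `|G(y; μ, ν)| ≤ ε` for every coarse site then, for EVERY fine direction `λ`,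
`|S2L k G (x + e_λ; μ, ν) − S2L k G (x; μ, ν)| ≤ 330 · 54^{d−1} · ε / (L^k)³` — the spread coarse curl is Lipschitz at scale `n = L^k`, one power of `n` better than
the sup bound `abs_S2L_le` (this is what the divergence clause `DivSmall` of a regular representative needs; the step profile of the landed lift gives only `~ ε/(L^k)²` here).
[folklore] -/
theorem abs_S2L_shift_sub_le (k : ℕ) (hk : k ≤ P.m + P.K) (G : Site P k → Fin P.d → Fin P.d → ℝ) (x : Site P 0) {μ ν : Fin P.d} (hμν : μ ≠ ν)
    (lam : Fin P.d) {ε : ℝ} (hG : ∀ y, |G y μ ν| ≤ ε) :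
    |S2L k G (x.shift lam) μ ν - S2L k G x μ ν| ≤ 330 * (54 : ℝ) ^ (P.d - 1) * ε / ((P.L : ℝ) ^ k) ^ 3 := by
  have hε : 0 ≤ ε := (abs_nonneg _).trans (hG (fun _ => 0))
  have hn : (0 : ℝ) < side (hh P k) := side_real_pos _
  have hN' := hN k hk
  have hνμ : ν ≠ μ := fun h => hμν h.symm
  -- the weight of `y` as a product over ALL coordinates of per-coordinate factors, at an arbitrary fine site `z`
  let w : Fin P.d → ZMod (P.sitesPerDir 0) → ZMod (P.sitesPerDir k) → ℝ := fun i a c =>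
    if i = μ ∨ i = ν then PtauL (hh P k) a c else PsigL (hh P k) a c
  have hw : ∀ (z : Site P 0) (y : Site P k), PtauL (hh P k) (z μ) (y μ) * PtauL (hh P k) (z ν) (y ν) * ∏ i ∈ (univ.erase μ).erase ν, PsigL (hh P k) (z i) (y i)
      = ∏ i, w i (z i) (y i) := by
    intro z y
    rw [← mul_prod_erase univ (fun i => w i (z i) (y i)) (mem_univ μ),
      ← mul_prod_erase (univ.erase μ) (fun i => w i (z i) (y i)) (mem_erase.mpr ⟨hνμ, mem_univ ν⟩)]
    simp only [w, if_pos (Or.inl rfl), if_pos (Or.inr rfl), mul_assoc]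
    congr 2
    exact prod_congr rfl fun i hi => by
      rw [if_neg (not_or.mpr ⟨ne_of_mem_erase (mem_of_mem_erase hi), ne_of_mem_erase hi⟩)]
  -- the difference of the weights is again a product, with the `λ`-factor replaced by its discrete derivative
  let v : Fin P.d → ZMod (P.sitesPerDir k) → ℝ := fun i c => if i = lam then w i (x i + 1) c - w i (x i) c else w i (x i) c
  have hvl : ∀ c, v lam c = w lam (x lam + 1) c - w lam (x lam) c := fun c => if_pos rfl
  have hdiff : ∀ y : Site P k, ∏ i, w i ((x.shift lam) i) (y i) - ∏ i, w i (x i) (y i) = ∏ i, v i (y i) := by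
    intro y
    rw [← mul_prod_erase univ (fun i => w i ((x.shift lam) i) (y i)) (mem_univ lam),
      ← mul_prod_erase univ (fun i => w i (x i) (y i)) (mem_univ lam),
      ← mul_prod_erase univ (fun i => v i (y i)) (mem_univ lam)]
    have e1 : ∏ i ∈ univ.erase lam, w i ((x.shift lam) i) (y i) = ∏ i ∈ univ.erase lam, w i (x i) (y i) :=
      prod_congr rfl fun i hi => by rw [shift_apply_ne x (ne_of_mem_erase hi)]
    have e2 : ∏ i ∈ univ.erase lam, v i (y i) = ∏ i ∈ univ.erase lam, w i (x i) (y i) :=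
      prod_congr rfl fun i hi => by
        show (if i = lam then w i (x i + 1) (y i) - w i (x i) (y i) else w i (x i) (y i)) = w i (x i) (y i)
        rw [if_neg (ne_of_mem_erase hi)]
    rw [e1, e2, shift_apply_self, hvl]
    ring
  -- per-coordinate sums of absolute values: the sup-type bounds `B i` and the Lipschitz gain `r = (330/54)/n` in the coordinate `λ`
  let B : Fin P.d → ℝ := fun i => if i = μ ∨ i = ν then (54 : ℝ) / (side (hh P k) : ℝ) else (54 : ℝ)
  have hB : ∀ i, ∑ c : ZMod (P.sitesPerDir k), |w i (x i) c| ≤ B i := by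
    intro i
    by_cases h : i = μ ∨ i = ν
    · simp only [w, B, if_pos h]; exact sum_abs_PtauL_le (hh P k) (x i)
    · simp only [w, B, if_neg h]; exact sum_abs_PsigL_le (hh P k) (x i)
  have hLip : ∑ c : ZMod (P.sitesPerDir k), |w lam (x lam + 1) c - w lam (x lam) c| ≤ (330 / 54) / (side (hh P k) : ℝ) * B lam := by
    by_cases h : lam = μ ∨ lam = ν
    · simp only [w, B, if_pos h]
      calc _ ≤ 330 / (side (hh P k) : ℝ) ^ 2 := sum_abs_PtauL_add_one_sub_le (hh P k) hN' (x lam)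
        _ = (330 / 54) / (side (hh P k) : ℝ) * (54 / (side (hh P k) : ℝ)) := by field_simp
    · simp only [w, B, if_neg h]
      calc _ ≤ 108 / (side (hh P k) : ℝ) := sum_abs_PsigL_add_one_sub_le (hh P k) hN' (x lam)
        _ ≤ (330 / 54) / (side (hh P k) : ℝ) * 54 := by
            rw [div_mul_eq_mul_div, div_le_div_iff_of_pos_right hn]; norm_num
  have hv : ∀ i, ∑ c : ZMod (P.sitesPerDir k), |v i c| ≤ (if i = lam then (330 / 54) / (side (hh P k) : ℝ) else 1) * B i := by
    intro i
    by_cases h : i = lam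
    · subst h
      rw [if_pos rfl]
      calc ∑ c, |v i c| = ∑ c, |w i (x i + 1) c - w i (x i) c| := sum_congr rfl fun c _ => by rw [hvl]
        _ ≤ _ := hLip
    · have e : ∀ c, v i c = w i (x i) c := fun c => if_neg h
      simp only [if_neg h, one_mul]
      calc ∑ c, |v i c| = ∑ c, |w i (x i) c| := sum_congr rfl fun c _ => by rw [e]
        _ ≤ B i := hB i
  -- the product of the sup-type bounds (the computation of `abs_S2L_le`)
  have hd : 2 ≤ P.d := by
    have : ({μ, ν} : Finset (Fin P.d)).card ≤ Fintype.card (Fin P.d) := Finset.card_le_univ _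
    rw [card_pair hμν, Fintype.card_fin] at this
    exact this
  have hprodB : ∏ i, B i = (54 : ℝ) ^ P.d / (side (hh P k) : ℝ) ^ 2 := by
    rw [← mul_prod_erase univ _ (mem_univ μ), ← mul_prod_erase (univ.erase μ) _ (mem_erase.mpr ⟨hνμ, mem_univ ν⟩)]
    simp only [B, if_pos (Or.inl rfl), if_pos (Or.inr rfl)]
    have hrest : ∏ i ∈ (univ.erase μ).erase ν, (if i = μ ∨ i = ν then (54 : ℝ) / (side (hh P k) : ℝ) else (54 : ℝ)) = (54 : ℝ) ^ ((univ.erase μ).erase ν).card := by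
      rw [← prod_const]
      exact prod_congr rfl fun i hi => by rw [if_neg (not_or.mpr ⟨ne_of_mem_erase (mem_of_mem_erase hi), ne_of_mem_erase hi⟩)]
    rw [hrest, card_erase_of_mem (mem_erase.mpr ⟨hνμ, mem_univ ν⟩), card_erase_of_mem (mem_univ μ), card_univ, Fintype.card_fin]
    have e : (54 : ℝ) ^ P.d = 54 * 54 * (54 : ℝ) ^ (P.d - 1 - 1) := by
      rw [← pow_two, ← pow_add]; congr 1; omega
    rw [e]; field_simp
  have hprodr : ∏ i : Fin P.d, (if i = lam then (330 / 54) / (side (hh P k) : ℝ) else 1) = (330 / 54) / (side (hh P k) : ℝ) := by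
    rw [prod_ite_eq']; simp
  -- assemble
  calc |S2L k G (x.shift lam) μ ν - S2L k G x μ ν|
      = |∑ y : Site P k, G y μ ν * ∏ i, v i (y i)| := by
        unfold S2L
        rw [← sum_sub_distrib]
        exact congrArg _ (sum_congr rfl fun y _ => by rw [hw, hw, ← mul_sub, hdiff])
    _ ≤ ∑ y : Site P k, |G y μ ν * ∏ i, v i (y i)| := abs_sum_le_sum_abs _ _
    _ ≤ ∑ y : Site P k, ε * ∏ i, |v i (y i)| := by
        refine sum_le_sum fun y _ => ?_
        rw [abs_mul, abs_prod]
        exact mul_le_mul_of_nonneg_right (hG y) (prod_nonneg fun i _ => abs_nonneg _)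
    _ = ε * ∏ i, ∑ c : ZMod (P.sitesPerDir k), |v i c| := by
        rw [← mul_sum, Finset.prod_univ_sum]
        rfl
    _ ≤ ε * ∏ i, ((if i = lam then (330 / 54) / (side (hh P k) : ℝ) else 1) * B i) := by
        refine mul_le_mul_of_nonneg_left ?_ hε
        exact prod_le_prod (fun i _ => sum_nonneg fun c _ => abs_nonneg _) fun i _ => hv i
    _ = ε * ((330 / 54) / (side (hh P k) : ℝ) * ((54 : ℝ) ^ P.d / (side (hh P k) : ℝ) ^ 2)) := by
        rw [prod_mul_distrib, hprodr, hprodB]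
    _ = 330 * (54 : ℝ) ^ (P.d - 1) * ε / ((P.L : ℝ) ^ k) ^ 3 := by
        have e : (54 : ℝ) ^ P.d = 54 * (54 : ℝ) ^ (P.d - 1) := by
          rw [← pow_succ']; congr 1; omega
        rw [e, show (side (hh P k) : ℝ) = (P.L : ℝ) ^ k by rw [hside]; push_cast; ring]
        have hL : (0 : ℝ) < (P.L : ℝ) ^ k := by rw [← show (side (hh P k) : ℝ) = (P.L : ℝ) ^ k by rw [hside]; push_cast; ring]; exact hn
        field_simp

end Summit.QuantumFields.YangMills.Theorems.LinearLiftSpreadLip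

end
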